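import Literature.NumberTheory.GaloisRepresentations.ChebotarevFromCyclic
import Literature.NumberTheory.GaloisRepresentations.ChebotarevCyclicProofs
import Literature.NumberTheory.GaloisRepresentations.ChebotarevCyclotomicProofs
import Literature.NumberTheory.GaloisRepresentations.ResidualRepUnique
import Literature.NumberTheory.GaloisRepresentations.ResidualGaloisRepOpenKernel
import HarnessLib

/-!
# Congruent Frobenius characteristic polynomials give the same residual representation

Topic `Literature/NumberTheory/GaloisRepresentations`; namespace
`Literature.NumberTheory.GaloisRepresentations`.  A theorems-only file (no definition, no named
fact; D-0026).

The standard argument "`a_q(f) ≡ a_q(g)`, `ε_f(q) q^{k-1} ≡ ε_g(q) q^{k'-1} (mod λ)` for all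
`q ∤ N` ⟹ `ρ̄_f ≅ ρ̄_g^{ss}`" (Deligne–Serre 1974, 6.7 and §8; Serre, Duke 54 (1987), §3.2;
Darmon–Diamond–Taylor 1995, Prop. 2.6 and p. 54), in the tree's vocabulary and UNCONDITIONALLY
(the tree proves the Chebotarev density theorem and the Brauer–Nesbitt theorem):

* `FramedGaloisRep.infinite_setOf_isArithFrobAt_apply_eq_of_isOpen_ker` — **Chebotarev,
  existence form, for every framed representation with open kernel over any coefficient ring**:
  for `σ : Γ_F →ₜ* GL_n(A)` with open kernel and `g ∈ Γ_F`, infinitely many finite places `v`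
  are unramified for `σ` and carry an arithmetic Frobenius `Φ` with `σ Φ = σ g` (the tree's
  `FramedGaloisRep.infinite_setOf_frobenius_eq_of_cyclic` fed with its proved cyclic case
  `infinite_setOf_frobenius_eq_of_isCyclic chebotarev_cyclotomicExtension_holds`; the complex
  case is `chebotarevArtinRep_holds`).
* `exists_monoidHom_prod_entries` — two homomorphisms `τ, τ' : G →* GL_n(k)` are the two
  projections of one homomorphism `G →* GL_n(k × k)` whose kernel is `ker τ ⊓ ker τ'` (so that
  Chebotarev applies to the PAIR).
* `FramedGaloisRep.charpoly_eq_of_isResidualRepOf_of_congruent` — **the theorem**: let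
  `ρ, ρ' : Γ_K → GL_n(ℚ̄_p)` be continuous and, at every finite place `v` outside a finite set
  `S`, unramified with Frobenius characteristic polynomials `P_v, P'_v ∈ ℤ̄_p[X]` that are
  CONGRUENT modulo the maximal ideal; then any residual representations `τ` of `ρ` and `τ'` of
  `ρ'` (over `ℤ̄_p/𝔪`) have the same characteristic polynomials everywhere — at a Frobenius `Φ`
  both are the reduction of `P_v ≡ P'_v`, and by Chebotarev applied to `(τ, τ')` every element of
  `Γ_K` has the same image as some such `Φ` under both;
* `FramedGaloisRep.nonempty_equiv_of_isResidualRepOf_of_congruent` — hence `τ ≃ τ'`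
  (Brauer–Nesbitt, `brauerNesbitt_holds`);
* `FramedGaloisRep.isResidualRepOf_of_isResidualRepOf_of_congruent` — and `τ` is also a
  residual representation of `ρ'` ("`ρ̄ = ρ̄'`").

## References

* P. Deligne, J.-P. Serre, Ann. Sci. ÉNS (4) 7 (1974), 6.7, §8.6. [DeligneSerreASENS1974]
* H. Darmon, F. Diamond, R. Taylor, *Fermat's Last Theorem* (1995), §2.1, Prop. 2.6, p. 54.
  [DarmonDiamondTaylor1995]
* J. Tate, in Cassels–Fröhlich (1967), Ch. VII §2.4 (Chebotarev). [TateGCFT1967]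
-/

noncomputable section

open scoped MatrixGroups NumberField
open Field IsDedekindDomain NumberField Polynomial IsLocalRing

namespace Literature.NumberTheory.GaloisRepresentations

/-! ### Chebotarev for every framed representation with open kernel -/

section Chebotarev

variable {F : Type} [Field F] [NumberField F] {A : Type*} [CommRing A] [TopologicalSpace A]
  {n : ℕ}

/-- **Chebotarev's density theorem, existence form, for a framed representation with open kernel
over any coefficient ring** (unconditional): for `σ : Γ_F →ₜ* GL_n(A)` with open kernel and
`g ∈ Γ_F` there are infinitely many finite places `v` of `F` at which `σ` is unramified and which
carry an arithmetic Frobenius `Φ` with `σ Φ = σ g`.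
[cite: TateGCFT1967, §2.4 (Tchebotarev density theorem) with Prop. 2.3] -/
theorem FramedGaloisRep.infinite_setOf_isArithFrobAt_apply_eq_of_isOpen_ker
    (σ : FramedGaloisRep F A n)
    (hker : IsOpen (σ.toMonoidHom.ker : Set (absoluteGaloisGroup F))) (g : absoluteGaloisGroup F) :
    {v : HeightOneSpectrum (𝓞 F) | σ.IsUnramifiedAt v ∧ ∃ 𝔓 ∈ v.primesAbove,
      ∃ Φ : absoluteGaloisGroup F, IsArithFrobAt (𝓞 F) Φ 𝔓 ∧ σ Φ = σ g}.Infinite :=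
  FramedGaloisRep.infinite_setOf_frobenius_eq_of_cyclic
    (fun _ _ _ _ _ _ _ _ g' hg' =>
      infinite_setOf_frobenius_eq_of_isCyclic chebotarev_cyclotomicExtension_holds g' hg')
    σ hker g

end Chebotarev

/-! ### Pairs of homomorphisms as one homomorphism over `k × k` -/

section Pair

variable {G : Type*} [Group G] {k : Type*} [CommRing k] {n : Type*} [Fintype n] [DecidableEq n]

omit [Fintype n] [DecidableEq n] in
/-- A matrix over `k × k` is determined by its two projections. [folklore] -/
theorem Matrix.eq_of_map_fst_eq_of_map_snd_eq {P Q : Matrix n n (k × k)}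
    (h1 : P.map (RingHom.fst k k) = Q.map (RingHom.fst k k))
    (h2 : P.map (RingHom.snd k k) = Q.map (RingHom.snd k k)) : P = Q := by
  ext i j
  · exact congrFun (congrFun h1 i) j
  · exact congrFun (congrFun h2 i) j

/-- **Two homomorphisms `τ, τ' : G →* GL_n(k)` are the projections of one homomorphism
`G →* GL_n(k × k)`**, entry `(i, j)` being the pair of entries, whose kernel is `ker τ ⊓ ker τ'`.
[folklore] -/
theorem exists_monoidHom_prod_entries (τ τ' : G →* GL n k) :
    ∃ π : G →* GL n (k × k),
      (∀ g, (π g).val.map (RingHom.fst k k) = (τ g).val) ∧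
      (∀ g, (π g).val.map (RingHom.snd k k) = (τ' g).val) ∧
      π.ker = τ.ker ⊓ τ'.ker := by
  -- the matrices of pairs
  let M : G → Matrix n n (k × k) := fun g i j => ((τ g).val i j, (τ' g).val i j)
  let Mi : G → Matrix n n (k × k) := fun g i j => (((τ g)⁻¹).val i j, ((τ' g)⁻¹).val i j)
  have hM1 : ∀ g, (M g).map (RingHom.fst k k) = (τ g).val := fun g => rfl
  have hM2 : ∀ g, (M g).map (RingHom.snd k k) = (τ' g).val := fun g => rfl
  have hMi1 : ∀ g, (Mi g).map (RingHom.fst k k) = ((τ g)⁻¹).val := fun g => rfl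
  have hMi2 : ∀ g, (Mi g).map (RingHom.snd k k) = ((τ' g)⁻¹).val := fun g => rfl
  have h1f : (1 : Matrix n n (k × k)).map (RingHom.fst k k) = 1 :=
    Matrix.map_one _ (map_zero _) (map_one _)
  have h1s : (1 : Matrix n n (k × k)).map (RingHom.snd k k) = 1 :=
    Matrix.map_one _ (map_zero _) (map_one _)
  have hmul : ∀ g, M g * Mi g = 1 := fun g =>
    Matrix.eq_of_map_fst_eq_of_map_snd_eq
      (by rw [Matrix.map_mul, hM1, hMi1, ← Units.val_mul, mul_inv_cancel, Units.val_one, h1f])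
      (by rw [Matrix.map_mul, hM2, hMi2, ← Units.val_mul, mul_inv_cancel, Units.val_one, h1s])
  have hmul' : ∀ g, Mi g * M g = 1 := fun g =>
    Matrix.eq_of_map_fst_eq_of_map_snd_eq
      (by rw [Matrix.map_mul, hM1, hMi1, ← Units.val_mul, inv_mul_cancel, Units.val_one, h1f])
      (by rw [Matrix.map_mul, hM2, hMi2, ← Units.val_mul, inv_mul_cancel, Units.val_one, h1s])
  let u : G → GL n (k × k) := fun g => ⟨M g, Mi g, hmul g, hmul' g⟩
  have hu : ∀ g, (u g).val = M g := fun g => rfl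
  refine ⟨{ toFun := u
            map_one' := Units.ext (Matrix.eq_of_map_fst_eq_of_map_snd_eq
              (by rw [hu, hM1, map_one, Units.val_one, Units.val_one, h1f])
              (by rw [hu, hM2, map_one, Units.val_one, Units.val_one, h1s]))
            map_mul' := fun g h => Units.ext (Matrix.eq_of_map_fst_eq_of_map_snd_eq
              (by rw [hu, hM1, map_mul, Units.val_mul, Units.val_mul, Matrix.map_mul, hu, hu,
                    hM1, hM1])
              (by rw [hu, hM2, map_mul, Units.val_mul, Units.val_mul, Matrix.map_mul, hu, hu,
                    hM2, hM2])) },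
    fun g => rfl, fun g => rfl, ?_⟩
  ext g
  simp only [MonoidHom.mem_ker, MonoidHom.coe_mk, OneHom.coe_mk, Subgroup.mem_inf]
  constructor
  · intro h
    have h' : (u g).val = 1 := by rw [h, Units.val_one]
    refine ⟨Units.ext ?_, Units.ext ?_⟩
    · rw [← hM1 g, ← hu, h', Units.val_one, h1f]
    · rw [← hM2 g, ← hu, h', Units.val_one, h1s]
  · rintro ⟨h1, h2⟩
    refine Units.ext (Matrix.eq_of_map_fst_eq_of_map_snd_eq ?_ ?_)
    · rw [hu, hM1, h1, Units.val_one, Units.val_one, h1f]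
    · rw [hu, hM2, h2, Units.val_one, Units.val_one, h1s]

end Pair

/-! ### The theorem -/

section Residual

/-- A group homomorphism out of a topological group with open kernel is continuous (private
copy of `MonoidHom.continuous_of_isOpen_ker` of `Automorphic/LanglandsTetrahedral`).
[folklore] -/
private theorem continuous_of_isOpen_ker_aux₅ {G H : Type*} [Group G] [TopologicalSpace G]
    [IsTopologicalGroup G] [Group H] [TopologicalSpace H] [ContinuousMul H] (f : G →* H)
    (hf : IsOpen (f.ker : Set G)) : Continuous f := by
  apply continuous_of_continuousAt_one f
  rw [ContinuousAt, map_one]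
  intro U hU
  rw [Filter.mem_map]
  apply Filter.mem_of_superset (hf.mem_nhds (by simp))
  intro g hg
  rw [SetLike.mem_coe, MonoidHom.mem_ker] at hg
  rw [Set.mem_preimage, hg]
  exact mem_of_mem_nhds hU

variable {K : Type} [Field K] [NumberField K] {p : ℕ} [Fact p.Prime] {n : ℕ}

/-- **Congruent Frobenius characteristic polynomials outside a finite set force equal residual
characteristic polynomials everywhere.**  Let `ρ, ρ' : Γ_K → GL_n(ℚ̄_p)` be continuous; suppose
that at every finite place `v ∉ S` (`S` finite) both are unramified with Frobenius characteristic
polynomials `P_v, P'_v ∈ ℤ̄_p[X]` (mapped to `ℚ̄_p[X]`) whose reductions modulo `𝔪` coincide.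
Then every residual representation `τ` of `ρ` and every residual representation `τ'` of `ρ'`
(over `ℤ̄_p/𝔪`) satisfy `charpoly τ(g) = charpoly τ'(g)` for ALL `g ∈ Γ_K`: both `τ, τ'` have
open kernel, so by Chebotarev (applied to the pair `(τ, τ')`, a homomorphism into
`GL_n(k × k)`) every `g` has `τ g = τ Φ`, `τ' g = τ' Φ` for an arithmetic Frobenius `Φ` at some
`v ∉ S`, where `charpoly τ(Φ) = P_v mod 𝔪 = P'_v mod 𝔪 = charpoly τ'(Φ)` (residual
characteristic polynomials are the reductions of the integral Frobenius polynomials).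
[cite: DarmonDiamondTaylor1995, §2.1, Prop. 2.6 and p. 54] [cite: DeligneSerreASENS1974, §8.6] -/
theorem FramedGaloisRep.charpoly_eq_of_isResidualRepOf_of_congruent
    (ρ ρ' : FramedGaloisRep K (PadicAlgCl p) n) {S : Set (HeightOneSpectrum (𝓞 K))}
    (hS : S.Finite)
    (h : ∀ v ∉ S, ρ.IsUnramifiedAt v ∧ ρ'.IsUnramifiedAt v ∧
      ∃ P P' : Polynomial (padicAlgClIntegers p),
        ρ.HasFrobCharpolyAt v (P.map (padicAlgClIntegers p).subtype) ∧
        ρ'.HasFrobCharpolyAt v (P'.map (padicAlgClIntegers p).subtype) ∧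
        P.map (residue (padicAlgClIntegers p)) = P'.map (residue (padicAlgClIntegers p)))
    {τ τ' : absoluteGaloisGroup K →* GL (Fin n) (padicAlgClResidueField p)}
    (hτ : ρ.IsResidualRepOf (RingHom.id _) τ) (hτ' : ρ'.IsResidualRepOf (RingHom.id _) τ')
    (g : absoluteGaloisGroup K) :
    ((τ g : GL (Fin n) (padicAlgClResidueField p)) :
        Matrix (Fin n) (Fin n) (padicAlgClResidueField p)).charpoly =
      ((τ' g : GL (Fin n) (padicAlgClResidueField p)) :
        Matrix (Fin n) (Fin n) (padicAlgClResidueField p)).charpoly := by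
  classical
  set k := padicAlgClResidueField p
  -- the pair `(τ, τ')` as one homomorphism with open kernel, made continuous for the discrete
  -- topology on `k × k`
  obtain ⟨π, hπ1, hπ2, hπker⟩ := exists_monoidHom_prod_entries τ τ'
  have hopen : IsOpen (π.ker : Set (absoluteGaloisGroup K)) := by
    rw [hπker, Subgroup.coe_inf]
    exact (FramedGaloisRep.isOpen_ker_of_isResidualRepOf hτ).inter
      (FramedGaloisRep.isOpen_ker_of_isResidualRepOf hτ')
  letI : TopologicalSpace (k × k) := ⊥
  haveI : DiscreteTopology (k × k) := ⟨rfl⟩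
  haveI : ContinuousAdd (k × k) := ⟨continuous_of_discreteTopology⟩
  haveI : ContinuousMul (k × k) := ⟨continuous_of_discreteTopology⟩
  let σ : FramedGaloisRep K (k × k) n := ⟨π, continuous_of_isOpen_ker_aux₅ π hopen⟩
  have hσker : IsOpen (σ.toMonoidHom.ker : Set (absoluteGaloisGroup K)) := hopen
  -- Chebotarev: a Frobenius `Φ` at some `v ∉ S` with `π Φ = π g`
  obtain ⟨v, ⟨-, 𝔓, h𝔓, Φ, hΦ, hπΦ⟩, hvS⟩ :=
    ((σ.infinite_setOf_isArithFrobAt_apply_eq_of_isOpen_ker hσker g).sdiff hS).nonempty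
  have hπΦ' : π Φ = π g := hπΦ
  have hτΦ : τ Φ = τ g := by
    refine Units.ext ?_
    rw [← hπ1 Φ, ← hπ1 g, hπΦ']
  have hτ'Φ : τ' Φ = τ' g := by
    refine Units.ext ?_
    rw [← hπ2 Φ, ← hπ2 g, hπΦ']
  -- at `Φ`: both residual characteristic polynomials are the reduction of `P_v ≡ P'_v`
  obtain ⟨-, -, P, P', hP, hP', hPP'⟩ := h v hvS
  have key : ∀ {ρ₀ : FramedGaloisRep K (PadicAlgCl p) n}
      {τ₀ : absoluteGaloisGroup K →* GL (Fin n) k} (_ : ρ₀.IsResidualRepOf (RingHom.id _) τ₀)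
      {P₀ : Polynomial (padicAlgClIntegers p)}
      (_ : ρ₀.HasFrobCharpolyAt v (P₀.map (padicAlgClIntegers p).subtype)),
      ((τ₀ Φ : GL (Fin n) k) : Matrix (Fin n) (Fin n) k).charpoly =
        P₀.map (residue (padicAlgClIntegers p)) := by
    intro ρ₀ τ₀ hτ₀ P₀ hP₀
    obtain ⟨P₁, hP₁, hP₁τ⟩ := hτ₀.hasResidualCharpolys Φ
    have e : ((ρ₀ Φ : GL (Fin n) (PadicAlgCl p)) : Matrix (Fin n) (Fin n) (PadicAlgCl p)).charpoly =
        P₀.map (padicAlgClIntegers p).subtype := hP₀ 𝔓 h𝔓 Φ hΦ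
    have hP₁P₀ : P₁ = P₀ :=
      Polynomial.map_injective _ (padicAlgClIntegers p).subtype_injective (hP₁.trans e)
    rw [← hP₁τ, hP₁P₀, RingHom.id_comp]
  rw [← hτΦ, ← hτ'Φ, key hτ hP, key hτ' hP', hPP']

/-- **Hence the residual representations are equivalent** (Brauer–Nesbitt, `brauerNesbitt_holds`:
both are semisimple with the same characteristic polynomials).
[cite: DarmonDiamondTaylor1995, §2.1, Prop. 2.6] -/
theorem FramedGaloisRep.nonempty_equiv_of_isResidualRepOf_of_congruent
    (ρ ρ' : FramedGaloisRep K (PadicAlgCl p) n) {S : Set (HeightOneSpectrum (𝓞 K))}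
    (hS : S.Finite)
    (h : ∀ v ∉ S, ρ.IsUnramifiedAt v ∧ ρ'.IsUnramifiedAt v ∧
      ∃ P P' : Polynomial (padicAlgClIntegers p),
        ρ.HasFrobCharpolyAt v (P.map (padicAlgClIntegers p).subtype) ∧
        ρ'.HasFrobCharpolyAt v (P'.map (padicAlgClIntegers p).subtype) ∧
        P.map (residue (padicAlgClIntegers p)) = P'.map (residue (padicAlgClIntegers p)))
    {τ τ' : absoluteGaloisGroup K →* GL (Fin n) (padicAlgClResidueField p)}
    (hτ : ρ.IsResidualRepOf (RingHom.id _) τ) (hτ' : ρ'.IsResidualRepOf (RingHom.id _) τ') :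
    Nonempty ((glRepresentation τ).Equiv (glRepresentation τ')) := by
  refine brauerNesbitt_holds (glRepresentation τ) (glRepresentation τ')
    hτ.isSemisimpleRepresentation hτ'.isSemisimpleRepresentation fun g => ?_
  have eτ : (glRepresentation τ g : (Fin n → _) →ₗ[_] (Fin n → _)) =
      Matrix.toLin' ((τ g : GL (Fin n) _) : Matrix (Fin n) (Fin n) _) :=
    LinearMap.ext fun v => by rw [Matrix.toLin'_apply]; rfl
  have eτ' : (glRepresentation τ' g : (Fin n → _) →ₗ[_] (Fin n → _)) =
      Matrix.toLin' ((τ' g : GL (Fin n) _) : Matrix (Fin n) (Fin n) _) :=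
    LinearMap.ext fun v => by rw [Matrix.toLin'_apply]; rfl
  rw [eτ, eτ', Matrix.charpoly_toLin', Matrix.charpoly_toLin']
  exact ρ.charpoly_eq_of_isResidualRepOf_of_congruent ρ' hS h hτ hτ' g

/-- Equivalent representations through `GL_n(k)` have the same kernel. [folklore] -/
theorem ker_eq_of_equiv_glRepresentation {G : Type*} [Group G] {k : Type*} [Field k] {m : ℕ}
    {τ τ' : G →* GL (Fin m) k} (e : (glRepresentation τ).Equiv (glRepresentation τ')) :
    τ.ker = τ'.ker := by
  have hint : ∀ g (v : Fin m → k), e (glRepresentation τ g v) = glRepresentation τ' g (e v) :=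
    fun g v => LinearMap.congr_fun (e.isIntertwining' g) v
  have hmat : ∀ {σ : G →* GL (Fin m) k} (g : G), σ g = 1 ↔ ∀ v, glRepresentation σ g v = v := by
    intro σ g
    constructor
    · intro hg v
      rw [glRepresentation_apply_apply, hg, Units.val_one, Matrix.one_mulVec]
    · intro hv
      refine Units.ext (Matrix.toLin'.injective ?_)
      rw [Units.val_one, Matrix.toLin'_one]
      exact LinearMap.ext fun v => by rw [Matrix.toLin'_apply, LinearMap.id_apply]; exact hv v
  ext g
  rw [MonoidHom.mem_ker, MonoidHom.mem_ker, hmat, hmat]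
  constructor
  · intro hg w
    obtain ⟨v, rfl⟩ := e.toLinearEquiv.surjective w
    have := hint g v
    rw [hg v] at this
    exact this.symm
  · intro hg v
    apply e.toLinearEquiv.injective
    have := hint g v
    rw [hg] at this
    exact this

/-- **"`ρ̄ = ρ̄'`": a residual representation of `ρ` is a residual representation of `ρ'`** when
their Frobenius characteristic polynomials are congruent outside a finite set (same
characteristic polynomials, `charpoly_eq_of_isResidualRepOf_of_congruent`; same kernel as the
equivalent `τ'`, `ker_eq_of_equiv_glRepresentation`; so `τ` is a semisimplification of the
reduction of `ρ'` of which `τ'` is one). [cite: DarmonDiamondTaylor1995, §2.1, Prop. 2.6 and p. 54] -/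
theorem FramedGaloisRep.isResidualRepOf_of_isResidualRepOf_of_congruent
    (ρ ρ' : FramedGaloisRep K (PadicAlgCl p) n) {S : Set (HeightOneSpectrum (𝓞 K))}
    (hS : S.Finite)
    (h : ∀ v ∉ S, ρ.IsUnramifiedAt v ∧ ρ'.IsUnramifiedAt v ∧
      ∃ P P' : Polynomial (padicAlgClIntegers p),
        ρ.HasFrobCharpolyAt v (P.map (padicAlgClIntegers p).subtype) ∧
        ρ'.HasFrobCharpolyAt v (P'.map (padicAlgClIntegers p).subtype) ∧
        P.map (residue (padicAlgClIntegers p)) = P'.map (residue (padicAlgClIntegers p)))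
    {τ τ' : absoluteGaloisGroup K →* GL (Fin n) (padicAlgClResidueField p)}
    (hτ : ρ.IsResidualRepOf (RingHom.id _) τ) (hτ' : ρ'.IsResidualRepOf (RingHom.id _) τ') :
    ρ'.IsResidualRepOf (RingHom.id _) τ := by
  obtain ⟨e⟩ := ρ.nonempty_equiv_of_isResidualRepOf_of_congruent ρ' hS h hτ hτ'
  have hker : τ.ker = τ'.ker := ker_eq_of_equiv_glRepresentation e
  obtain ⟨τ₁, hred, hss, hcp, hk⟩ := hτ'
  refine ⟨τ₁, hred, hτ.isSemisimpleRepresentation, fun g => ?_, ?_⟩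
  · rw [ρ.charpoly_eq_of_isResidualRepOf_of_congruent ρ' hS h hτ ⟨τ₁, hred, hss, hcp, hk⟩ g]
    exact hcp g
  · rw [hker]
    exact hk

end Residual

end Literature.NumberTheory.GaloisRepresentations

end
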